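import Literature.NumberTheory.EllipticCurves.Rubin1983.BernoulliDescentSeven
import Literature.NumberTheory.EllipticCurves.KrizLi2019.TeichmullerCharacterExists
import Literature.NumberTheory.EllipticCurves.QuadraticTwistJInvariantProofs
import Literature.NumberTheory.QuadraticFields.KroneckerSplitting
import Literature.NumberTheory.QuadraticFields.FundamentalDiscriminant
import Summits.BirchSwinnertonDyer.Rank1Residual.X12.O11.RouteUBernoulliD11
import Summits.BirchSwinnertonDyer.Rank1Residual.X12.O11.RouteUQuadraticTwin
import Summits.BirchSwinnertonDyer.Rank1Residual.X12.O11.RouteUPsiD11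
import Summits.BirchSwinnertonDyer.Rank1Residual.X12.O11.RouteUTwistCM
import Summits.BirchSwinnertonDyer.Rank1Residual.X11b.Three.CornerDischarge
import Literature.NumberTheory.EllipticCurves.BSDRootNumberSmallConductorAssemblyProofs
import Literature.NumberTheory.EllipticCurves.AnalyticRankOrderProofs
import Literature.NumberTheory.EllipticCurves.LFunctionSmulProofs
import Mathlib.NumberTheory.LegendreSymbol.JacobiSymbol
import Mathlib.Tactic.NormNum.LegendreSymbol
import HarnessLib

/-!
# ROUTE U for `D = −11` — the TWIN SIDE BY NAME: `7 ∤ #Ш(49a1^{(209)})` from Rubin 1983 Thm C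
# (named fact `Rubin1983.thmC_seven_quadraticField`) + the kernel certificate `7 ∤ β₂(−11, −19)`

bsd-cm cell, ROUTE U (Theorem U: BSD(49a1^{(D)}, 7) ⇒ full BSD on `𝒞₇`), member `D = −11`
(`5929e1`), Heegner field `K'' = ℚ(√−19)`; planner ORDER v4.9 item (3) / TARGET R185 (A) «twin
side BY NAME». The kernel theorem `RouteU.bsdp_seven_of_twist_cm7_D11` displays the binder
`hSd : ∀ [Finite Wd.sha], ¬ 7 ∣ Wd.shaOrder` for (any model `Wd` of) the rank-`0` twin
`W^{(d_{K''})} = 49a1^{(−11)(−19)} = 49a1^{(209)}`. This file DISCHARGES it from the published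
named fact (Rubin, Invent. math. 71 (1983) Thm C at `p = 7` over the real quadratic field
`M = ℚ(√209)`, tree `Literature…Rubin1983.thmC_seven_quadraticField`, landed p400707) and kernel
certificates only:

* (`‖B_{1,ω}‖₇ = 1` for every Teichmüller `ω` mod `7` — Rubin's `χ = 1` condition — is
  `norm_bernoulliOnePrim_teichmuller_seven` of `RouteUBernoulliD11`; the generic quadratic-field /
  twist lemmas are in `RouteUQuadraticTwin`);
* `jacobiChar209_apply` / `jacobiChar209_isPrimitive` / `jacobiChar209_even` — the character
  `χ₁₁↑·χ₁₉↑` mod `209` has values `(a/209)` (Jacobi), is primitive and even;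
* `kroneckerValue_of_discr_eq_209` / `exists_kroneckerChar_209` — for ANY quadratic number field `M`
  with `d_M = 209` it IS the Kronecker character of `M` (the generic decomposition-law lemma
  `kroneckerValue_of_discr_eq_pos` of `RouteUQuadraticTwin` at `m = 209`);
* `norm_bernoulliOnePrim_mulTeichmuller_209` — `‖B_{1,χ_{209}ω}‖₇ = 1`: Rubin's `χ = χ_M` number IS
  Route U's `β₂(−11,−19) = B_{1,ωχ_{−11}χ_{−19}}`, certified in `RouteUBernoulliD11`
  (`norm_generalizedBernoulli_theta2_D11`, `theta2D11_isPrimitive/apply` of `RouteUPsiD11`);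
* **`not_seven_dvd_shaOrder_twin_D11`** — for every model `Wd` of `W^{(−19)}`, `W` any model of
  `49a1^{(−11)}`, with `Ш(Wd)` finite: `7 ∤ #Ш(Wd)`, from `(h : Rubin1983.thmC_seven_quadraticField)`
  ALONE (the field `M = ℚ(√209)` is produced inside by `Quadratic.exists_numberField_discr_eq`);
* **`twin_value_D11`** — the twin's VALUE binder `htw` (`∃ q ∈ ℚ, L(Wd,1)/Ω_{Wd} = q ∧ ord₇ q =
  ord₇ #Ш + ord₇ Tam − 2 ord₇ #tors`) from the published named fact Burungale–Flach 2024
  (`bsdTriple_of_hasCM_of_L_one_ne_zero`, full BSD for CM curves with `L(1) ≠ 0`) BY NAME, plus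
  GZK/`hmod` (bookkeeping `X11b.Three.exists_LOne_div_realPeriodRat_of_bsdp_rankZero`).

THEOREMS ONLY; no new definitions, no new named facts; nothing booked.
References: [Rubin1983] Thm C (p. 341); [BuhlerGross1985] Prop. (8.4)(1) / Cor. (9.1) (the
printed descent behind Thm C); [BurungaleFlach2024] Thm 1.1 / Cor. 2; [Miller2011LMS] Def. 1.1; [KrizLi2019] §1.5 (Bernoulli numbers of primitive characters);
[Washington1997] §5.1, Thm. 4.2; [Cox2013] Lemma 1.14 (the Kronecker character of a quadratic field).
-/

noncomputable section

open scoped Classical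
open NumberField WeierstrassCurve DirichletCharacter
open Literature.NumberTheory.EllipticCurves Literature.NumberTheory.EllipticCurves.KrizLi2019
open Literature.NumberTheory.EllipticCurves.Rubin1983 (mulTeichmuller thmC_seven_quadraticField)
open Literature.NumberTheory.QuadraticFields

namespace Summit.BirchSwinnertonDyer.Rank1Residual.X12.O11.RouteU

/-! ## §1 The Jacobi character mod `209 = 11 · 19` -/

section Chi

variable (χ : DirichletCharacter ℚ_[7] 11) (ε : DirichletCharacter ℚ_[7] 19)

/-- **Values of `χ₁₁↑ · χ₁₉↑` mod `209`**: for Legendre-valued `χ` mod `11` and `ε` mod `19`,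
`(χ↑·ε↑)(a) = (a/11)(a/19) = J(a | 209)` for every natural `a` (both sides vanish when
`gcd(a, 209) > 1`). [cite: Cox2013, §1.C Lemma 1.14 (the character n ↦ (n/|d_K|))] -/
theorem jacobiChar209_apply (hχ : ∀ a : ℕ, χ (a : ZMod 11) = (legendreSym 11 (a : ℤ) : ℚ_[7]))
    (hε : ∀ a : ℕ, ε (a : ZMod 19) = (legendreSym 19 (a : ℤ) : ℚ_[7])) (a : ℕ) :
    (changeLevel (by norm_num : 11 ∣ 209) χ * changeLevel (by norm_num : 19 ∣ 209) ε) (a : ZMod 209)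
      = (jacobiSym a 209 : ℚ_[7]) := by
  have hJ : jacobiSym a 209 = legendreSym 11 a * legendreSym 19 a := by
    rw [show (209 : ℕ) = 11 * 19 by norm_num, jacobiSym.mul_right,
      ← jacobiSym.legendreSym.to_jacobiSym, ← jacobiSym.legendreSym.to_jacobiSym]
  have ha : ((a : ℤ) : ZMod 209) = (a : ZMod 209) := Int.cast_natCast a
  by_cases hu : IsCoprime (a : ℤ) ((209 : ℕ) : ℤ)
  · rw [← ha, MulChar.mul_apply, changeLevel_eq_cast_of_dvd' _ _ hu,
      changeLevel_eq_cast_of_dvd' _ _ hu, Int.cast_natCast, Int.cast_natCast, hχ, hε, hJ,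
      Int.cast_mul]
  · have hnu : ¬ IsUnit (a : ZMod 209) := by
      rw [← ha, ZMod.coe_int_isUnit_iff_isCoprime]; exact fun h => hu (isCoprime_comm.mp h)
    rw [MulChar.map_nonunit _ hnu]
    -- `gcd(a, 209) ≠ 1`, so `J(a | 209) = 0`
    have hg : (a : ℤ).gcd 209 ≠ 1 := fun h1 => hu (Int.isCoprime_iff_gcd_eq_one.mpr h1)
    rw [jacobiSym.eq_zero_iff.mpr ⟨by norm_num, hg⟩, Int.cast_zero]

/-- `χ₁₁↑ · χ₁₉↑` mod `209` is **primitive** (conductors `11`, `19` coprime). [folklore] -/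
theorem jacobiChar209_isPrimitive
    (hχ : ∀ a : ℕ, χ (a : ZMod 11) = (legendreSym 11 (a : ℤ) : ℚ_[7]))
    (hε : ∀ a : ℕ, ε (a : ZMod 19) = (legendreSym 19 (a : ℤ) : ℚ_[7])) :
    (changeLevel (by norm_num : 11 ∣ 209) χ * changeLevel (by norm_num : 19 ∣ 209) ε).IsPrimitive := by
  have hc11 := conductor_eq_of_prime_of_ne_one χ (legendre11_ne_one χ hχ)
  have hc19 := conductor_eq_of_prime_of_ne_one ε (legendre19_ne_one ε hε)
  change DirichletCharacter.conductor _ = 209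
  rw [conductor_changeLevel_mul_changeLevel _ _ χ ε (by rw [hc11, hc19]; norm_num), hc11, hc19]

/-- `χ₁₁↑ · χ₁₉↑` mod `209` is **even** (`J(−1 | 209) = 1` as `209 ≡ 1 (mod 4)`). [folklore] -/
theorem jacobiChar209_even
    (hχ : ∀ a : ℕ, χ (a : ZMod 11) = (legendreSym 11 (a : ℤ) : ℚ_[7]))
    (hε : ∀ a : ℕ, ε (a : ZMod 19) = (legendreSym 19 (a : ℤ) : ℚ_[7])) :
    (changeLevel (by norm_num : 11 ∣ 209) χ * changeLevel (by norm_num : 19 ∣ 209) ε).Even := by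
  change _ = (1 : ℚ_[7])
  have h : (-1 : ZMod 209) = ((208 : ℕ) : ZMod 209) := by decide
  rw [h, jacobiChar209_apply χ ε hχ hε 208]
  norm_num

set_option maxRecDepth 20000 in
/-- **`‖B_{1,χ_{209}ω}‖₇ = 1`** — Rubin's `χ = χ_M` factor for `M = ℚ(√209)` IS Route U's
`β₂(−11, −19) = B_{1,ωχ_{−11}χ_{−19}}` (kernel certificate `norm_generalizedBernoulli_theta2_D11`):
`mulTeichmuller (χ↑·ε↑) ω = χ↑·ε↑·ω↑` at level `1463`, primitive (`theta2D11_isPrimitive`), with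
the certified values (`theta2D11_apply`). [cite: Rubin1983, §0 Thm. C (p. 341)]
[cite: KrizLi2019, §1.5 display (1) (p. 7)] -/
theorem norm_bernoulliOnePrim_mulTeichmuller_209 (ω : DirichletCharacter ℚ_[7] 7)
    (hω : IsTeichmullerCharacter ω)
    (hχ : ∀ a : ℕ, χ (a : ZMod 11) = (legendreSym 11 (a : ℤ) : ℚ_[7]))
    (hε : ∀ a : ℕ, ε (a : ZMod 19) = (legendreSym 19 (a : ℤ) : ℚ_[7])) :
    ‖bernoulliOnePrim (mulTeichmuller
      (changeLevel (by norm_num : 11 ∣ 209) χ * changeLevel (by norm_num : 19 ∣ 209) ε) ω)‖ = 1 := by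
  haveI : NeZero (77 * 19) := ⟨by norm_num⟩
  have hΘ : mulTeichmuller
      (changeLevel (by norm_num : 11 ∣ 209) χ * changeLevel (by norm_num : 19 ∣ 209) ε) ω =
      (changeLevel (by norm_num : 11 ∣ 77 * 19) χ * changeLevel (by norm_num : 19 ∣ 77 * 19) ε *
        changeLevel (by norm_num : 7 ∣ 77 * 19) ω : DirichletCharacter ℚ_[7] (77 * 19)) := by
    rw [mulTeichmuller, map_mul, ← changeLevel_trans, ← changeLevel_trans]
  rw [hΘ, bernoulliOnePrim_eq_of_isPrimitive _ (theta2D11_isPrimitive ω χ ε hω hχ hε)]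
  exact norm_generalizedBernoulli_theta2_D11 ω hω _ (theta2D11_apply ω χ ε hχ hε)

end Chi

/-! ## §2 The Kronecker character of a quadratic field of discriminant `209` -/

/-- **The decomposition law in `ℚ(√209)` read on the Jacobi character.** Let `M` be a quadratic
number field with `d_M = 209` and `κ` a character mod `|d_M|` with `κ(a) = J(a | 209)` for all
`a`. Then for every prime `ℓ ∤ 209`: `κ(ℓ) = 1` if `ℓ` splits in `M` and `−1` otherwise
(`Quadratic.ncard_primesOver_eq_two_iff_legendreSym` / `…_two_eq_two_iff`, and quadratic
reciprocity `J(209 | ℓ) = J(ℓ | 209)` for odd `ℓ`, `209 ≡ 1 (mod 4)`; `209 ≡ 1 (mod 8)` at `ℓ = 2`).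
[cite: Cox2013, §1.C Lemma 1.14 and (1.18)] -/
theorem kroneckerValue_of_discr_eq_209 {M : Type} [Field M] [NumberField M]
    (hM2 : Module.finrank ℚ M = 2) (hdM : NumberField.discr M = 209)
    {n : ℕ} (κ : DirichletCharacter ℚ_[7] n) (hκ : ∀ a : ℕ, κ (a : ZMod n) = (jacobiSym a 209 : ℚ_[7]))
    (ℓ : ℕ) (hℓ : ℓ.Prime) (hnd : ¬ ((ℓ : ℤ) ∣ NumberField.discr M)) :
    κ (ℓ : ZMod n) =
      if ((Ideal.span {(ℓ : ℤ)}).primesOver (𝓞 M)).ncard = 2 then 1 else -1 :=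
  kroneckerValue_of_discr_eq_pos hM2 (m := 209) (by norm_num) (by exact_mod_cast hdM) κ
    (fun a => by exact_mod_cast hκ a) ℓ hℓ hnd

/-- **At a level `n = 209` (a variable, so that `n := |d_M|` can be substituted): a primitive even
character `κ` mod `n` with values `J(· | 209)` whose Rubin number `B_{1,κω}` is a `7`-adic unit**,
for every Teichmüller `ω`. [cite: Rubin1983, §0 Thm. C (p. 341)] -/
theorem exists_kroneckerChar_209 (ω : DirichletCharacter ℚ_[7] 7) (hω : IsTeichmullerCharacter ω)
    (n : ℕ) [NeZero n] (hn : n = 209) :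
    ∃ κ : DirichletCharacter ℚ_[7] n, κ.IsPrimitive ∧ κ.Even ∧
      (∀ a : ℕ, κ (a : ZMod n) = (jacobiSym a 209 : ℚ_[7])) ∧
      ‖bernoulliOnePrim (mulTeichmuller κ ω)‖ = 1 := by
  subst hn
  obtain ⟨χ, hχ⟩ := exists_legendreCharacter 11
  obtain ⟨ε, hε⟩ := exists_legendreCharacter 19
  exact ⟨_, jacobiChar209_isPrimitive χ ε hχ hε, jacobiChar209_even χ ε hχ hε,
    jacobiChar209_apply χ ε hχ hε, norm_bernoulliOnePrim_mulTeichmuller_209 χ ε ω hω hχ hε⟩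

/-! ## §3 The twin binder `hSd` of `bsdp_seven_of_twist_cm7_D11`, by name -/

/-- `209 = 11 · 19` is a fundamental discriminant (`≡ 1 (mod 4)`, squarefree, `≠ 1`). [folklore] -/
theorem isFundamental_209 :
    ((209 : ℤ) % 4 = 1 ∧ Squarefree (209 : ℤ) ∧ (209 : ℤ) ≠ 1) ∨
      (4 ∣ (209 : ℤ) ∧ ((209 : ℤ) / 4 % 4 = 2 ∨ (209 : ℤ) / 4 % 4 = 3) ∧
        Squarefree ((209 : ℤ) / 4)) := by
  refine Or.inl ⟨by norm_num, ?_, by norm_num⟩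
  rw [show (209 : ℤ) = ((209 : ℕ) : ℤ) by norm_num, Int.squarefree_natCast,
    show (209 : ℕ) = 11 * 19 by norm_num, Nat.squarefree_mul (by norm_num)]
  exact ⟨(by norm_num : Nat.Prime 11).squarefree, (by norm_num : Nat.Prime 19).squarefree⟩

/-- **ROUTE U, `D = −11`: the TWIN SIDE BY NAME.** For every model `W/ℚ` of `49a1^{(−11)}` and
every elliptic model `Wd` of its twist `W^{(−19)}` (`= 49a1^{(209)}` up to `ℚ`-isomorphism) with
`Ш(Wd)` finite: **`7 ∤ #Ш(Wd)`**, from Rubin 1983 Thm C at `p = 7` over `M = ℚ(√209)` (named fact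
`Rubin1983.thmC_seven_quadraticField`, BY NAME) — its three conditions discharged in the kernel:
`7 ∤ B_{1,ω}²` (§1), `χ_M` even and `7 ∤ B_{1,χ_Mω}²` = Route U's `7 ∤ β₂(−11,−19)²` (§2), with
`M` produced by `Quadratic.exists_numberField_discr_eq` and `χ_M = J(·|209)` identified as its
Kronecker character (§3). This is the binder `hSd` of `RouteU.bsdp_seven_of_twist_cm7_D11`.
[cite: Rubin1983, §0 Thm. C (p. 341)] [cite: BuhlerGross1985, Prop. (8.4)(1) and Cor. (9.1) (pp. 18)] -/
theorem not_seven_dvd_shaOrder_twin_D11 (h : thmC_seven_quadraticField)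
    (W : WeierstrassCurve ℚ)
    (hW : ∃ C : VariableChange ℚ, C • W = cm7.quadraticTwist ((-11 : ℤ) : ℚ))
    (Wd : WeierstrassCurve ℚ) [Wd.IsElliptic] (Cd : VariableChange ℚ)
    (hWd : Cd • W.quadraticTwist ((-19 : ℤ) : ℚ) = Wd) [Finite Wd.sha] :
    ¬ 7 ∣ Wd.shaOrder := by
  obtain ⟨ω, hω⟩ := exists_isTeichmullerCharacter (p := 7)
  obtain ⟨M, _, _, hM2, hdM⟩ := Quadratic.exists_numberField_discr_eq isFundamental_209
  haveI : NeZero (NumberField.discr M).natAbs := ⟨by rw [hdM]; decide⟩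
  obtain ⟨κ, hprim, heven, hval, hu⟩ :=
    exists_kroneckerChar_209 ω hω (NumberField.discr M).natAbs (by rw [hdM]; rfl)
  have hK : IsKroneckerCharacterOf M κ :=
    ⟨hprim, fun ℓ hℓ hnd => kroneckerValue_of_discr_eq_209 hM2 hdM κ hval ℓ hℓ hnd⟩
  have h7 : ¬ ((7 : ℤ) ∣ NumberField.discr M) := by rw [hdM]; decide
  have hB₁ := not_norm_mul_le_inv_of_norm_eq_one (p := 7)
    (norm_bernoulliOnePrim_teichmuller_seven ω hω) (norm_bernoulliOnePrim_teichmuller_seven ω hω)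
  have hB₂ := not_norm_mul_le_inv_of_norm_eq_one (p := 7) hu hu
  have hWd' : ∃ C' : VariableChange ℚ, C' • cm7.quadraticTwist (NumberField.discr M : ℚ) = Wd := by
    rw [hdM, show ((209 : ℤ) : ℚ) = ((-11 : ℤ) : ℚ) * ((-19 : ℤ) : ℚ) by norm_num]
    exact exists_variableChange_cm7_twist_twist W hW Wd Cd hWd
  have := Rubin1983.not_dvd_shaOrder_twist_of_bernoulli h ω hω M hM2 h7 κ hK
    (by exact_mod_cast hB₁) heven (by exact_mod_cast hB₂) Wd hWd'
  exact this

/-! ## §4 The twin's VALUE binder `htw` from Burungale–Flach 2024 (BY NAME) -/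

/-- **The twin `Wd` (a model of `(49a1^{(−11)})^{(−19)} ≅ 49a1^{(209)}`) is a CM curve.**
[cite: SilvermanATAEC1994, App. A §3 (table of CM j-invariants)] -/
theorem hasCM_twin_D11 (W : WeierstrassCurve ℚ)
    (hW : ∃ C : VariableChange ℚ, C • W = cm7.quadraticTwist ((-11 : ℤ) : ℚ))
    (Wd : WeierstrassCurve ℚ) [Wd.IsElliptic] (Cd : VariableChange ℚ)
    (hWd : Cd • W.quadraticTwist ((-19 : ℤ) : ℚ) = Wd) : Wd.HasCM := by
  obtain ⟨C', hC'⟩ := exists_variableChange_cm7_twist_twist W hW Wd Cd hWd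
  have h209 : cm7.quadraticTwist (((-11 : ℤ) : ℚ) * ((-19 : ℤ) : ℚ)) =
      cm7.quadraticTwist ((209 : ℤ) : ℚ) := by norm_num
  exact hasCM_of_twist_cm7 Wd (D := 209) (by norm_num) ⟨C'⁻¹, by rw [← hC', inv_smul_smul, h209]⟩

/-- **ROUTE U, `D = −11`: the twin's value binder `htw` by name.** For every model `W` of
`49a1^{(−11)}` and every globally minimal elliptic model `Wd` of `W^{(−19)}` with
`L(W^{(−19)}, 1) ≠ 0`: `L(Wd,1)/Ω_{Wd} ∈ ℚ` with `ord₇ = ord₇ #Ш(Wd) + ord₇ Tam(Wd) − 2 ord₇ #Wd(ℚ)_tors`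
— from Burungale–Flach's full BSD for CM curves of analytic rank `0`
(`hBF : bsdTriple_of_hasCM_of_L_one_ne_zero`; `Wd` is CM, being a model of `cm7^{(209)}`), read at
`p = 7` through `forall_bsdp_of_bsdTriple'` and the rank-`0` bookkeeping
`X11b.Three.exists_LOne_div_realPeriodRat_of_bsdp_rankZero` (GZK, `hmod`).
[cite: BurungaleFlach2024, Thm 1.1 and Cor. 2] [cite: Miller2011LMS, §1 and Def. 1.1 (arXiv:1010.2431 p. 3)] -/
theorem twin_value_D11 (hBF : bsdTriple_of_hasCM_of_L_one_ne_zero)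
    (hGZK : rank_eq_analyticRank_of_analyticRank_le_one) (hmod : hasEntireLFunction_rat)
    (W : WeierstrassCurve ℚ) [W.IsElliptic]
    (hW : ∃ C : VariableChange ℚ, C • W = cm7.quadraticTwist ((-11 : ℤ) : ℚ))
    (Wd : WeierstrassCurve ℚ) [Wd.IsElliptic] [Wd.IsGloballyMinimal] (Cd : VariableChange ℚ)
    (hWd : Cd • W.quadraticTwist ((-19 : ℤ) : ℚ) = Wd)
    (hLt : (W.quadraticTwist ((-19 : ℤ) : ℚ)).entireLFunction 1 ≠ 0) :
    ∃ q : ℚ, Wd.entireLFunction 1 / (Wd.realPeriodRat : ℂ) = (q : ℂ) ∧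
      padicValRat 7 q = (padicValNat 7 Wd.shaOrder : ℤ) + padicValNat 7 Wd.tamagawaProduct -
        2 * padicValNat 7 Wd.torsionOrder := by
  haveI : Fact (Nat.Prime 7) := ⟨by norm_num⟩
  -- `Wd` is CM: a model of `cm7^{(209)}`
  have hCM : Wd.HasCM := hasCM_twin_D11 W hW Wd Cd hWd
  -- `L(Wd, 1) ≠ 0`, so `r_an(Wd) = 0`
  have hL : Wd.entireLFunction 1 ≠ 0 := by
    have h' : W.quadraticTwist ((-19 : ℤ) : ℚ) = Cd⁻¹ • Wd := by rw [← hWd, inv_smul_smul]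
    rw [h', entireLFunction_smul] at hLt
    exact hLt
  have hr0 : Wd.analyticRank = 0 := (analyticRank_eq_zero_iff_holds (W := Wd) (hmod Wd)).mpr hL
  exact X11b.Three.exists_LOne_div_realPeriodRat_of_bsdp_rankZero hGZK hmod Wd 7 hr0
    (forall_bsdp_of_bsdTriple' Wd (hBF Wd hCM hL) 7 (by norm_num))

end Summit.BirchSwinnertonDyer.Rank1Residual.X12.O11.RouteU

end
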